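import Literature.NumberTheory.LFunctions.KMVMollifiedMomentForms
import HarnessLib

/-!
# The constrained Cauchy–Schwarz envelope `Δ/(2(Δ+4))` of KMV's central-value ratio under the
# extra linear constraint `P(1) = 0` (model-(A) cost of the Siegel-point constraint; first rung
# OUTSIDE print of the §D fam card `siegel-point-annihilation`, redraw r1)

Topic `Literature/NumberTheory/LFunctions` (namespace `Literature.NumberTheory.LFunctions.KMV2000`,
the grouping sub-namespace of `KMVMollifiedMomentForms.lean`, whose objects `unitIntegral`,
`ratio`, `Admissible`, `envelope` this file is about). Cell `landau-siegel` (LANDAU–SIEGEL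
PROGRAMME, rung F-S3), §D typer for edge fam = the ½-proportion edge; card
`siegel-point-annihilation` REDRAW r1 (ls-knife-fam-idea-1 g2, 2026-08-27T02:09Z; draft
`knife/fam/idea-1/CARD-siegel-point-annihilation-r1.md` sha16 8e71c6463e6791e7, Sketch
`Sketch-siegel-point-annihilation-r1.lean` sha16 8375c7b3ef27cd9b, rc 0 on the farm). PROOFS only —
every statement below is a kernel theorem about the tree's REAL definitions; no named fact
(`def … : Prop`) and no new definition is introduced (the Sketch's `csTest`, `modelAProfile` are
written out as the literal polynomials `(3/2)X − 1/2` and `X³ − X²`).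

## What the card says (r1, «NEW IN r1 — THE ADDRESS OF THE (A)-BLOCK IS COMPUTED», item P4)

KMV's main-order Cauchy–Schwarz ratio for the central value (`Q = 1`, admissible `P`:
`P(0) = P′(0) = 0`) is `ratio Δ P 1 = P′(1)² / (2 (P′(1)² + Δ⁻¹ ∫₀¹ P″²))`, with supremum
`envelope Δ = Δ/(2(1+Δ))` (tree: `KMV2000.ratio_one_le`, attained at `P = x²`, `ratio_one_X_sq`)
[cite: KowalskiMichelVanderKam2000, Theorem 6.1 and §7 p. 21]. The card: under model (A)
(`χ_D(p) = −1` for every prime `p ≤ M·Y`) the order-0 Eisenstein pairing row acts on KMV profiles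
at leading order as the EVALUATION `P ↦ c·P(1)`, so annihilating the Siegel point costs exactly the
constraint `P(1) = 0`, «and the constrained KMV envelope drops from `Δ/(2(1+Δ))` to `Δ/(2(Δ+4))`
… attained at `P = x³ − x²` …: relative cost `cos²θ_A = 3/(Δ+4) = 3/5` at `Δ = 1` — ORDER ONE».
This file lands exactly that constrained optimisation (the card's P4 «PROVED in Sketch r1, to
land»):

* `four_mul_sq_le_of_eval_one_eq_zero` — the weighted Cauchy–Schwarz step: `P(0) = P′(0) = 0`
  and `P(1) = 0` ⇒ `4·P′(1)² ≤ ∫₀¹ P″²` (test function `g = (3x−1)/2`, the component of `1`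
  orthogonal to `1 − x` in `L²[0,1]`; `∫₀¹ g P″ = P′(1)`, `∫₀¹ g² = 1/4`).
* `ratio_one_le_of_eval_one_eq_zero` — `0 < Δ`, `Admissible P`, `P.eval 1 = 0` ⇒
  `ratio Δ P 1 ≤ Δ/(2(Δ+4))`.
* `ratio_one_modelAProfile` — attained: `ratio Δ (X³ − X²) 1 = Δ/(2(Δ+4))`
  (`admissible_X_cube_sub_X_sq`, `eval_one_X_cube_sub_X_sq`: the profile is admissible and
  satisfies the constraint).
* `modelA_relative_cost` — `1 − [Δ/(2(Δ+4))]/envelope Δ = 3/(Δ+4)`; `modelA_relative_cost_one` —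
  `= 3/5` at `Δ = 1`; `constrainedEnvelope_lt_envelope` — `Δ/(2(Δ+4)) < envelope Δ` for `0 < Δ`
  (the constraint always costs at main order); `constrainedEnvelope_one` — `= 1/10` at `Δ = 1`
  against `envelope 1 = 1/4` (`KMV2000.ratio_one_X_sq_at_one`).

WHAT THIS IS NOT: the identification of the model-(A) Eisenstein row with the evaluation
functional (the card's informal `ModelARowIsEvaluation`) is NOT in this file (typed separately);
nothing here touches the card's cruxes K1 (cost lemma), K2 (GAP-2 bracket), K3 (S0), which are NOT
typed as facts; no claim about the ½-proportion edge.
«The programme SEARCHES and TYPES; no claim about Landau–Siegel zeros, Theorems 1–2 of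
arXiv:2211.02515 or a repaired Margin232 until a kernel theorem says so.»

## References

* [KowalskiMichelVanderKam2000] E. Kowalski, P. Michel, J. VanderKam, *Non-vanishing of high
  derivatives of automorphic L-functions at the center of the critical strip*, J. reine angew.
  Math. 526 (2000), Theorem 6.1 (32) p. 20 and §7 p. 21 (unconstrained optimum `P₀ = x²`; no
  constrained optimum in print) — held `paper:doi-10-1515-crll-2000-074`, read by the typer of
  `KMVMollifiedMomentForms.lean` 2026-08-26.
* Tree: `Literature.NumberTheory.LFunctions.KMV2000.{unitIntegral, ratio, Admissible, envelope,
  linForm_one, offDiagForm_one, ratio_one_le, ratio_one_X_sq}` (`KMVMollifiedMomentForms.lean`).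
-/

noncomputable section

open Polynomial intervalIntegral MeasureTheory Set

namespace Literature.NumberTheory.LFunctions.KMV2000

/-! ### Folklore calculus of `unitIntegral` (the tree's helpers are `private`; re-proved here,
again `private`) -/

/-- Polynomial functions are interval-integrable. [folklore] -/
private theorem intervalIntegrable_eval (R : ℝ[X]) (a b : ℝ) :
    IntervalIntegrable (fun y : ℝ => R.eval y) volume a b :=
  (Polynomial.continuous R).intervalIntegrable a b

/-- Fundamental theorem of calculus: `∫₀¹ S′ = S(1) − S(0)`. [folklore] -/
private theorem unitIntegral_derivative_eq_sub (S : ℝ[X]) :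
    unitIntegral (derivative S) = S.eval 1 - S.eval 0 := by
  unfold unitIntegral
  exact integral_eq_sub_of_hasDerivAt (fun x _ => Polynomial.hasDerivAt S x)
    (intervalIntegrable_eval _ 0 1)

/-- Additivity of `∫₀¹`. [folklore] -/
private theorem unitIntegral_add_eq (R₁ R₂ : ℝ[X]) :
    unitIntegral (R₁ + R₂) = unitIntegral R₁ + unitIntegral R₂ := by
  unfold unitIntegral
  simp only [eval_add]
  exact intervalIntegral.integral_add (intervalIntegrable_eval R₁ 0 1)
    (intervalIntegrable_eval R₂ 0 1)

/-- `∫₀¹ (R₁ − R₂) = ∫₀¹ R₁ − ∫₀¹ R₂`. [folklore] -/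
private theorem unitIntegral_sub_eq (R₁ R₂ : ℝ[X]) :
    unitIntegral (R₁ - R₂) = unitIntegral R₁ - unitIntegral R₂ := by
  unfold unitIntegral
  simp only [eval_sub]
  exact intervalIntegral.integral_sub (intervalIntegrable_eval R₁ 0 1)
    (intervalIntegrable_eval R₂ 0 1)

/-- `∫₀¹ c·R = c·∫₀¹ R`. [folklore] -/
private theorem unitIntegral_C_mul_eq (c : ℝ) (R : ℝ[X]) :
    unitIntegral (C c * R) = c * unitIntegral R := by
  unfold unitIntegral
  simp only [eval_mul, eval_C]
  exact intervalIntegral.integral_const_mul c _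

/-- `0 ≤ ∫₀¹ R²`. [folklore] -/
private theorem unitIntegral_pow_two_nonneg (R : ℝ[X]) : 0 ≤ unitIntegral (R ^ 2) :=
  intervalIntegral.integral_nonneg zero_le_one fun y _ => by rw [eval_pow]; positivity

/-! ### The Cauchy–Schwarz test function `g = (3x − 1)/2 = 1 − (3/2)(1 − x)` -/

/-- `g² = S′` with `S = (3/4)x³ − (3/4)x² + (1/4)x`. [folklore] -/
private theorem csTest_sq_eq_derivative :
    (C (3/2 : ℝ) * X - C (1/2 : ℝ)) ^ 2 =
      derivative (C (3/4 : ℝ) * X ^ 3 - C (3/4 : ℝ) * X ^ 2 + C (1/4 : ℝ) * X) := by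
  apply Polynomial.funext
  intro y
  simp only [derivative_add, derivative_sub, derivative_mul, derivative_C, derivative_X,
    derivative_X_pow, eval_add, eval_sub, eval_mul, eval_pow, eval_C, eval_X, zero_mul, zero_add,
    mul_one, Nat.cast_ofNat]
  ring

/-- `∫₀¹ g² = 1/4` for `g = (3x − 1)/2`. [folklore] -/
private theorem unitIntegral_csTest_sq :
    unitIntegral ((C (3/2 : ℝ) * X - C (1/2 : ℝ)) ^ 2) = 1 / 4 := by
  rw [csTest_sq_eq_derivative, unitIntegral_derivative_eq_sub]
  norm_num

/-- Integration by parts as a polynomial identity: `(1 − x) P″ = ((1 − x) P′)′ + P′`.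
[folklore] -/
private theorem one_sub_X_mul_derivative_two (P : ℝ[X]) :
    (C 1 - X) * derivative (derivative P) =
      derivative ((C 1 - X) * derivative P) + derivative P := by
  rw [derivative_mul, derivative_sub, derivative_C, derivative_X]
  ring

/-- `∫₀¹ (1 − x) P″(x) dx = P(1) − P(0) − P′(0)`. [folklore] -/
private theorem unitIntegral_one_sub_X_mul_derivative_two (P : ℝ[X]) :
    unitIntegral ((C 1 - X) * derivative (derivative P)) =
      P.eval 1 - P.eval 0 - (derivative P).eval 0 := by
  rw [one_sub_X_mul_derivative_two, unitIntegral_add_eq, unitIntegral_derivative_eq_sub,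
    unitIntegral_derivative_eq_sub]
  simp only [eval_mul, eval_sub, eval_C, eval_X, sub_self, zero_mul, sub_zero, one_mul, zero_sub]
  ring

/-- `g·R = R − (3/2)(1 − x)R` for `g = (3x − 1)/2`. [folklore] -/
private theorem csTest_mul (R : ℝ[X]) :
    (C (3/2 : ℝ) * X - C (1/2 : ℝ)) * R = R - C (3/2 : ℝ) * ((C 1 - X) * R) := by
  apply Polynomial.funext
  intro y
  simp only [eval_sub, eval_mul, eval_C, eval_X, map_one, eval_one]
  ring

/-- `∫₀¹ g P″ = (P′(1) − P′(0)) − (3/2)(P(1) − P(0) − P′(0))` for `g = (3x − 1)/2`. [folklore] -/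
private theorem unitIntegral_csTest_mul_derivative_two (P : ℝ[X]) :
    unitIntegral ((C (3/2 : ℝ) * X - C (1/2 : ℝ)) * derivative (derivative P)) =
      ((derivative P).eval 1 - (derivative P).eval 0)
        - (3/2 : ℝ) * (P.eval 1 - P.eval 0 - (derivative P).eval 0) := by
  rw [csTest_mul, unitIntegral_sub_eq, unitIntegral_C_mul_eq, unitIntegral_derivative_eq_sub,
    unitIntegral_one_sub_X_mul_derivative_two]

/-! ### The constrained envelope -/

/-- **Weighted Cauchy–Schwarz under the Siegel-point constraint.** If `P(0) = P′(0) = 0`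
(`Admissible P`) AND `P(1) = 0`, then `4·P′(1)² ≤ ∫₀¹ P″²` (equality iff `P″ ∝ 3x − 1`, i.e.
`P ∝ x³ − x²`). Card `siegel-point-annihilation` r1, P4 (Sketch
`four_mul_sq_le_of_eval_one_eq_zero`). [cite: KowalskiMichelVanderKam2000, Theorem 6.1 (32) — the
unconstrained step there is `P′(1)² ≤ ∫₀¹P″²`] -/
theorem four_mul_sq_le_of_eval_one_eq_zero {P : ℝ[X]} (hP : Admissible P)
    (h1 : P.eval 1 = 0) :
    4 * (derivative P).eval 1 ^ 2 ≤ unitIntegral (derivative (derivative P) ^ 2) := by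
  have hg : unitIntegral ((C (3/2 : ℝ) * X - C (1/2 : ℝ)) * derivative (derivative P)) =
      (derivative P).eval 1 := by
    have h := unitIntegral_csTest_mul_derivative_two P
    rw [hP.1, hP.2, h1] at h
    linarith
  have h0 : 0 ≤ unitIntegral ((derivative (derivative P)
      - C (4 * (derivative P).eval 1) * (C (3/2 : ℝ) * X - C (1/2 : ℝ))) ^ 2) :=
    unitIntegral_pow_two_nonneg _
  have hexp : (derivative (derivative P)
      - C (4 * (derivative P).eval 1) * (C (3/2 : ℝ) * X - C (1/2 : ℝ))) ^ 2 =
      derivative (derivative P) ^ 2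
        - C (8 * (derivative P).eval 1) *
            ((C (3/2 : ℝ) * X - C (1/2 : ℝ)) * derivative (derivative P))
        + C (16 * (derivative P).eval 1 ^ 2) * (C (3/2 : ℝ) * X - C (1/2 : ℝ)) ^ 2 := by
    simp only [map_mul, map_pow, C_ofNat]
    ring
  rw [hexp, unitIntegral_add_eq, unitIntegral_sub_eq, unitIntegral_C_mul_eq, unitIntegral_C_mul_eq,
    hg, unitIntegral_csTest_sq] at h0
  nlinarith [h0]

/-- **MODEL-(A) COST OF THE SIEGEL-POINT CONSTRAINT (the card's rung P4, outside print).** For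
`0 < Δ`, an admissible profile with `P(1) = 0` has `ratio Δ P 1 ≤ Δ/(2(Δ+4))` — against the
unconstrained envelope `envelope Δ = Δ/(2(1+Δ))` of `ratio_one_le`. Card
`siegel-point-annihilation` r1: «the constrained KMV envelope drops from `Δ/(2(1+Δ))` to
`Δ/(2(Δ+4))`». [cite: KowalskiMichelVanderKam2000, Theorem 6.1 and §7 p. 21 (unconstrained
optimum only)] -/
theorem ratio_one_le_of_eval_one_eq_zero {Δ : ℝ} (hΔ : 0 < Δ) {P : ℝ[X]} (hP : Admissible P)
    (h1 : P.eval 1 = 0) : ratio Δ P 1 ≤ Δ / (2 * (Δ + 4)) := by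
  unfold ratio secondMomentForm
  rw [linForm_one, offDiagForm_one]
  have hCS := four_mul_sq_le_of_eval_one_eq_zero hP h1
  have hJ : 0 ≤ unitIntegral (derivative (derivative P) ^ 2) := unitIntegral_pow_two_nonneg _
  generalize (derivative P).eval 1 = a at hCS ⊢
  generalize unitIntegral (derivative (derivative P) ^ 2) = J at hCS hJ ⊢
  rcases eq_or_lt_of_le (sq_nonneg a) with ha | ha
  · rw [← ha]
    simp only [zero_add, zero_div]
    positivity
  · rw [div_le_div_iff₀ (by positivity) (by positivity)]
    have hΔJ : Δ⁻¹ * (4 * a ^ 2) ≤ Δ⁻¹ * J :=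
      mul_le_mul_of_nonneg_left hCS (le_of_lt (inv_pos.mpr hΔ))
    have hkey : a ^ 2 * (2 * (Δ + 4)) = 2 * (a ^ 2 + Δ⁻¹ * (4 * a ^ 2)) * Δ := by
      field_simp
    rw [hkey]
    have h2 : 2 * (a ^ 2 + Δ⁻¹ * (4 * a ^ 2)) * Δ ≤ 2 * (a ^ 2 + Δ⁻¹ * J) * Δ := by
      have : a ^ 2 + Δ⁻¹ * (4 * a ^ 2) ≤ a ^ 2 + Δ⁻¹ * J := by linarith
      nlinarith
    linarith [h2, mul_comm Δ (2 * (a ^ 2 + Δ⁻¹ * J))]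

/-! ### The model-(A) optimal profile `P_A = x³ − x²` attains the constrained envelope -/

/-- `P_A = x³ − x²` is admissible: `P_A(0) = P_A′(0) = 0`. Card r1, P4 (`admissible_modelAProfile`).
[cite: KowalskiMichelVanderKam2000, Theorem 6.1 (admissibility `P(0) = P′(0) = 0`)] -/
theorem admissible_X_cube_sub_X_sq : Admissible (X ^ 3 - X ^ 2 : ℝ[X]) := by
  constructor <;> simp

/-- `P_A = x³ − x²` satisfies the Siegel-point constraint `P_A(1) = 0`. Card r1, P4
(`modelAProfile_eval_one`). [cite: KowalskiMichelVanderKam2000, Theorem 6.1 (profiles `P`; the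
constraint `P(1) = 0` is the card's, not the source's)] -/
theorem eval_one_X_cube_sub_X_sq : (X ^ 3 - X ^ 2 : ℝ[X]).eval 1 = 0 := by simp

/-- `P_A″ = 6x − 2 = 4·g`, `g = (3x − 1)/2`. Card r1, P4 (`modelAProfile_dd`). [folklore] -/
private theorem derivative_two_X_cube_sub_X_sq :
    derivative (derivative (X ^ 3 - X ^ 2 : ℝ[X])) =
      C (4 : ℝ) * (C (3/2 : ℝ) * X - C (1/2 : ℝ)) := by
  apply Polynomial.funext
  intro y
  simp only [derivative_sub, derivative_mul, derivative_C, derivative_X_pow, eval_sub, eval_mul,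
    eval_pow, eval_C, eval_X, zero_mul, zero_add, Nat.cast_ofNat]
  ring

/-- `∫₀¹ (P_A″)² = ∫₀¹ (6x − 2)² = 4`. Card r1, P4 (`unitIntegral_modelAProfile_dd`). [folklore] -/
private theorem unitIntegral_derivative_two_X_cube_sub_X_sq_sq :
    unitIntegral (derivative (derivative (X ^ 3 - X ^ 2 : ℝ[X])) ^ 2) = 4 := by
  rw [derivative_two_X_cube_sub_X_sq, mul_pow, ← map_pow, unitIntegral_C_mul_eq,
    unitIntegral_csTest_sq]
  norm_num

/-- **The constrained bound is attained**: `ratio Δ (x³ − x²) 1 = Δ/(2(Δ+4))` for `0 < Δ`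
(`P_A′(1) = 1`, `∫₀¹(P_A″)² = 4`). Card `siegel-point-annihilation` r1, P4
(`ratio_one_modelAProfile`, «attained at `P = x³ − x²`»). [cite: KowalskiMichelVanderKam2000,
§7 p. 21 (the unconstrained optimum `P₀ = x²`; no constrained optimum in print)] -/
theorem ratio_one_modelAProfile {Δ : ℝ} (hΔ : 0 < Δ) :
    ratio Δ (X ^ 3 - X ^ 2) 1 = Δ / (2 * (Δ + 4)) := by
  unfold ratio secondMomentForm
  rw [linForm_one, offDiagForm_one, unitIntegral_derivative_two_X_cube_sub_X_sq_sq]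
  have hd : (derivative (X ^ 3 - X ^ 2 : ℝ[X])).eval 1 = 1 := by
    norm_num
  rw [hd]
  have hΔ0 : Δ ≠ 0 := ne_of_gt hΔ
  rw [div_eq_div_iff (by positivity) (by positivity)]
  field_simp

/-- **The relative cost under model (A)**: `1 − [Δ/(2(Δ+4))]/[Δ/(2(1+Δ))] = 3/(Δ+4)` — the card's
`cos²θ_A` («relative cost `cos²θ_A = 3/(Δ+4)` … ORDER ONE»). Card r1, P4 (`modelA_relative_cost`).
[cite: KowalskiMichelVanderKam2000, §7 p. 21 (envelope `Δ/(2(1+Δ))`)] -/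
theorem modelA_relative_cost {Δ : ℝ} (hΔ : 0 < Δ) :
    1 - (Δ / (2 * (Δ + 4))) / envelope Δ = 3 / (Δ + 4) := by
  unfold envelope
  have hΔ0 : Δ ≠ 0 := ne_of_gt hΔ
  rw [div_div_eq_mul_div]
  field_simp
  ring

/-- At `Δ = 1` the relative cost is `3/5` («`= 3/5` at `Δ = 1`», card r1).
[cite: KowalskiMichelVanderKam2000, §7 p. 21 and §1 Theorem 1.1 (`Δ → 1`, `p₀ = 1/4`)] -/
theorem modelA_relative_cost_one : 1 - ((1 : ℝ) / (2 * (1 + 4))) / envelope 1 = 3 / 5 := by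
  rw [modelA_relative_cost one_pos]
  norm_num

/-- The constraint always costs at main order: `Δ/(2(Δ+4)) < envelope Δ = Δ/(2(1+Δ))` for
`0 < Δ`. [cite: KowalskiMichelVanderKam2000, §7 p. 21 (envelope)] -/
theorem constrainedEnvelope_lt_envelope {Δ : ℝ} (hΔ : 0 < Δ) :
    Δ / (2 * (Δ + 4)) < envelope Δ := by
  unfold envelope
  rw [div_lt_div_iff₀ (by positivity) (by positivity)]
  nlinarith

/-- At `Δ = 1` the constrained envelope is `1/10` of all forms (against `envelope 1 = 1/4`,
`KMV2000.ratio_one_X_sq_at_one`): the card's «constrained proportion ceiling `(1+Δ)/(Δ+4)` of the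
unconstrained one» at `Δ = 1` is `2/5`.
[cite: KowalskiMichelVanderKam2000, §1 Theorem 1.1 and §7 p. 21 (`p₀ = 1/4` at `Δ → 1`)] -/
theorem constrainedEnvelope_one : (1 : ℝ) / (2 * (1 + 4)) = (2 / 5) * envelope 1 := by
  unfold envelope
  norm_num

/-- Summary in the card's words: for `0 < Δ`, every admissible profile obeying the model-(A)
Siegel-point constraint `P(1) = 0` has `ratio Δ P 1 ≤ (1 − 3/(Δ+4)) · envelope Δ`, i.e. it retains
at most the fraction `(1+Δ)/(Δ+4)` of the unconstrained Cauchy–Schwarz envelope. Card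
`siegel-point-annihilation` r1 («the (A)-world pays for Siegel-point deafness in MOLLIFIER
EFFICIENCY (the constrained proportion ceiling `(1+Δ)/(Δ+4)` of the unconstrained one)»).
[cite: KowalskiMichelVanderKam2000, Theorem 6.1 and §7 p. 21] -/
theorem ratio_one_le_mul_envelope_of_eval_one_eq_zero {Δ : ℝ} (hΔ : 0 < Δ) {P : ℝ[X]}
    (hP : Admissible P) (h1 : P.eval 1 = 0) :
    ratio Δ P 1 ≤ ((1 + Δ) / (Δ + 4)) * envelope Δ := by
  have h := ratio_one_le_of_eval_one_eq_zero hΔ hP h1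
  have hΔ0 : Δ ≠ 0 := ne_of_gt hΔ
  have heq : ((1 + Δ) / (Δ + 4)) * envelope Δ = Δ / (2 * (Δ + 4)) := by
    unfold envelope
    field_simp
  rw [heq]
  exact h

end Literature.NumberTheory.LFunctions.KMV2000

end
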